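import Literature.NumberTheory.EllipticCurves.Kato2004.EllipticZetaReciprocity
import Literature.NumberTheory.EllipticCurves.RankinSelbergLFunctionK
import Literature.NumberTheory.LFunctions.RayClassOfIdealHom
import Literature.NumberTheory.LFunctions.CubicRayClassCharacterCount
import Literature.NumberTheory.LFunctions.NormDirichletCharacter
import Literature.NumberTheory.GaloisRepresentations.AlgebraicHeckeCharacterNormValues
import Literature.NumberTheory.GaloisRepresentations.HeckeCharacterModulusExponentProofs
import Mathlib.RingTheory.Ideal.GoingUp
import HarnessLib

set_option autoImplicit false

/-!
# `𝒞₇` genus road (crux `EllipticUnitValueSevenOfGZK`, K7r), row (K2C-4) block (X-a), file 2 of 3: THE DEPLETED TWISTED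
# HECKE SERIES `L_{(m)}(ψ̄, χ, s)` AS AN `ℕ`-INDEXED DIRICHLET SERIES, Weil's exponent `|ψ(ϖ_v)| = N v^{1/2}` of a
# type-`(1,0)` Grössencharacter

Cell bsd-cm, seat bsd-cm-prr-ty1 g32 (literature-prover), SUMMON `wake/SUMMON-bsd-cm-prr-ty1-20260830T2007Z.md` (planner
bsd-cm-plan g36, D945; key K2C-4), block (X-a) «THE DICTIONARY DISCHARGE», move (1) COEFFICIENTS of p784707's docstring, and
STATUS CHECK (CONJ) of this seat.  HONEST LABEL: THEOREMS ONLY — no `def`, no named fact, no typed hypothesis, no instance,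
no notation, no `sorry`; general number field `K` (file 3 specialises to the frame).  stmt-BirchSwinnertonDyer-19945 is
OPEN; `X12.CMRamifiedSeven` NOT proved; no summit statement is proved by this seat; BSD is claimed for no curve.

## What is proved (numbers, not adjectives)

* §0 `heckeCharIdealValue_eq_idealPow` — the tree's `CM.heckeCharIdealValue ψ 𝔞` (Kato2004/EllipticZetaReciprocity) IS
  `LFunctions.idealPow K ψ.valueAtUniformizer 𝔞` for `𝔞 ≠ 0`.
* §A COPRIMALITY `isCoprime_iff_forall_not_le`, `isCoprime_span_natCast_iff`, `coprime_absNorm_iff`,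
  `isCoprime_span_natCast_iff_coprime_absNorm` — `𝔞 ≠ 0` is prime to `(m)` iff `gcd(N𝔞, m) = 1` (induction on the
  factorisation; tree `coprime_absNorm_of_natCast_not_mem` / `not_coprime_absNorm_of_natCast_mem` at the primes).
* §B `idealPow_absNorm_cpow` (`∏ (N𝔭^s)^{ν_𝔭(𝔞)} = N𝔞^s`, via `idealPow_apply_asIdeal`), `idealPow_mul_absNorm_cpow`,
  `norm_heckeCharIdealValue_le` (`|ψ(𝔭)| ≤ N𝔭^{1/2}` at primes ⇒ `|ψ(𝔞)| ≤ N𝔞^{1/2}`).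
* §C REGROUPING `hasSum_ideal` (the tree's `hasSum_ideal_twistCount` for any absolutely convergent `g`, not only `|g| ≤ 1`) and
  `depletedHeckeLSeries_eq_LSeries`: for `re s > 3/2`, `|ψ(𝔭)| ≤ N𝔭^{1/2}`, `|χ(𝔞)| ≤ 1` on the ideals prime to `(m)`,
  `CM.depletedHeckeLSeries ψ χ m s = LSeries c s`, `c(n) = Σ_{N𝔞 = n, (𝔞,(m))=1} conj ψ(𝔞) · χ(𝔞)`.
* §D WEIL'S EXPONENT `norm_valueAtUniformizer_of_hasInfinityType_one_zero` — for `K` totally complex and `ψ` of infinity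
  type `(1,0)`: `|ψ(ϖ_v)| = N v^{1/2}` at EVERY finite place (`HasInfinityType.norm_valueAtUniformizer_sq` off a module of
  definition, weight `1` as every `mult = 2`; one exponent at all places, `exists_norm_valueAtUniformizer_eq_rpow_neg`);
  `exists_not_mem_finset` (a place outside any finite set).

## References
J. Neukirch, *Algebraic Number Theory* (1999) I §3 (3.3), §8; VII §8 (8.1) [NeukirchANT1999]; A. Weil, *On a certain type of
characters…* (1956) [Weil1956]; A. Weil, *Basic Number Theory* (1967) VII §7 ¶1 [WeilBNT1967]; K. Kato, Astérisque 295 (2004)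
§15.7 (pp. 255–256), Prop. 15.9 (p. 258) [Kato2004Asterisque]; J. H. Silverman, *Advanced Topics* (1994) II Thm. 10.5
[SilvermanATAEC1994]; S. Patrikis, arXiv:1207.6724 §2.1 [Patrikis2019].
-/

noncomputable section

open scoped NumberField
open Field NumberField IsDedekindDomain
open Literature.NumberTheory.GaloisRepresentations
open Literature.NumberTheory.EllipticCurves
open Literature.NumberTheory.EllipticCurves.Kato2004
open Literature.NumberTheory.LFunctions

namespace Summit.BirchSwinnertonDyer.Rank1Residual.Additive.GenusSeven

namespace DepletedSeries

open scoped ComplexConjugate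

/-! ## §0 `heckeCharIdealValue` is `idealPow` -/

section IdealValues

variable {K : Type} [Field K] [NumberField K]

/-- The tree's `CM.heckeCharIdealValue ψ I` (idelic Hecke character on ideals) IS `idealPow K ψ.valueAtUniformizer I` for
`I ≠ 0`. [cite: Kato2004Asterisque, §15.7 (pp. 255–256)] -/
theorem heckeCharIdealValue_eq_idealPow (ψ : HeckeCharacter K) {I : Ideal (𝓞 K)} (hI : I ≠ ⊥) :
    CM.heckeCharIdealValue ψ I = idealPow K (fun v => ψ.valueAtUniformizer v) I := by
  classical
  rw [CM.heckeCharIdealValue, if_neg hI, idealPow]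
  refine finprod_congr fun v => ?_
  rw [Ideal.count_associates_factors_eq hI v.isPrime v.ne_bot]

end IdealValues

/-! ## §A Coprimality of an ideal with `(m)` is coprimality of its norm with `m` -/

section Coprime

variable {K : Type} [Field K] [NumberField K]

/-- `I` is prime to `J` iff no nonzero prime contains both (in `𝓞 K`, whose maximal ideals are the nonzero primes).
[cite: NeukirchANT1999, Ch. I §3 (3.3)] -/
theorem isCoprime_iff_forall_not_le (I J : Ideal (𝓞 K)) :
    IsCoprime I J ↔ ∀ v : HeightOneSpectrum (𝓞 K), I ≤ v.asIdeal → ¬ J ≤ v.asIdeal := by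
  constructor
  · intro h v hIv hJv
    have htop := Ideal.isCoprime_iff_sup_eq.mp h
    have hle : I ⊔ J ≤ v.asIdeal := sup_le hIv hJv
    rw [htop, top_le_iff] at hle
    exact v.isPrime.ne_top hle
  · intro h
    rw [Ideal.isCoprime_iff_sup_eq]
    by_contra hne
    obtain ⟨M, hM, hle⟩ := Ideal.exists_le_maximal _ hne
    have hM0 : M ≠ ⊥ := Ring.ne_bot_of_isMaximal_of_not_isField hM (RingOfIntegers.not_isField K)
    exact h ⟨M, hM.isPrime, hM0⟩ (le_sup_left.trans hle) (le_sup_right.trans hle)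

/-- `I` is prime to `(m)` iff no prime containing `I` contains `m`. [cite: NeukirchANT1999, Ch. I §3 (3.3)] -/
theorem isCoprime_span_natCast_iff (I : Ideal (𝓞 K)) (m : ℕ) :
    IsCoprime I (Ideal.span {(m : 𝓞 K)}) ↔
      ∀ v : HeightOneSpectrum (𝓞 K), I ≤ v.asIdeal → (m : 𝓞 K) ∉ v.asIdeal := by
  rw [isCoprime_iff_forall_not_le]
  exact forall₂_congr fun v _ => by rw [Ideal.span_singleton_le_iff_mem]

/-- **`gcd(N𝔞, m) = 1` iff no prime factor of `𝔞 ≠ 0` contains `m`** (`N𝔭 = p^f` with `p` the prime under `𝔭`; induction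
on the factorisation). [cite: NeukirchANT1999, Ch. I §3 (3.3) and §8] -/
theorem coprime_absNorm_iff {I : Ideal (𝓞 K)} (hI : I ≠ ⊥) (m : ℕ) :
    (Ideal.absNorm I).Coprime m ↔ ∀ v : HeightOneSpectrum (𝓞 K), v.asIdeal ∣ I → (m : 𝓞 K) ∉ v.asIdeal := by
  induction I using UniqueFactorizationMonoid.induction_on_prime with
  | h₁ => exact absurd rfl hI
  | h₂ J hJ =>
    rw [Ideal.isUnit_iff] at hJ
    subst hJ
    rw [← Ideal.one_eq_top, map_one]
    refine ⟨fun _ v hv => ?_, fun _ => Nat.coprime_one_left m⟩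
    exact absurd (Ideal.isUnit_iff.mp (isUnit_of_dvd_one hv)) v.isPrime.ne_top
  | h₃ J P hJ hP ih =>
    have hP' : P.IsPrime := Ideal.isPrime_of_prime hP
    let w : HeightOneSpectrum (𝓞 K) := ⟨P, hP', hP.ne_zero⟩
    rw [map_mul, Nat.coprime_mul_iff_left, ih hJ]
    constructor
    · rintro ⟨hPm, hJm⟩ v hv
      rcases (Ideal.prime_of_isPrime v.ne_bot v.isPrime).dvd_or_dvd hv with h | h
      · haveI := hP'
        have hPv : P = v.asIdeal := (Ring.DimensionLeOne.prime_le_prime_iff_eq hP.ne_zero).mp (Ideal.le_of_dvd h)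
        intro hm
        exact not_coprime_absNorm_of_natCast_mem w (by rw [show w.asIdeal = P from rfl, hPv]; exact hm) hPm
      · exact hJm v h
    · intro h
      refine ⟨?_, fun v hv => h v (Dvd.dvd.mul_left hv P)⟩
      exact coprime_absNorm_of_natCast_not_mem w (h w (Dvd.intro J rfl))

/-- **`𝔞 ≠ 0` is prime to `(m)` iff `gcd(N𝔞, m) = 1`.** [cite: NeukirchANT1999, Ch. I §3 (3.3) and §8] -/
theorem isCoprime_span_natCast_iff_coprime_absNorm {I : Ideal (𝓞 K)} (hI : I ≠ ⊥) (m : ℕ) :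
    IsCoprime I (Ideal.span {(m : 𝓞 K)}) ↔ (Ideal.absNorm I).Coprime m := by
  rw [isCoprime_span_natCast_iff, coprime_absNorm_iff hI]
  exact forall_congr' fun v => by rw [Ideal.dvd_iff_le]

end Coprime

/-! ## §B `idealPow` of a norm power; the norm of `ψ(𝔞)` -/

section NormPow

variable {K : Type} [Field K] [NumberField K]

/-- **`∏_𝔭 (N𝔭^s)^{ν_𝔭(𝔞)} = N𝔞^s`** (the norm is multiplicative). [folklore] -/
theorem idealPow_absNorm_cpow (s : ℂ) {I : Ideal (𝓞 K)} (hI : I ≠ ⊥) :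
    idealPow K (fun v => ((Ideal.absNorm v.asIdeal : ℕ) : ℂ) ^ s) I = ((Ideal.absNorm I : ℕ) : ℂ) ^ s := by
  let f : Ideal (𝓞 K) →* ℂ :=
    { toFun := fun J => ((Ideal.absNorm J : ℕ) : ℂ) ^ s
      map_one' := by simp
      map_mul' := fun J J' => by
        simp only [map_mul, Nat.cast_mul]
        exact Complex.natCast_mul_natCast_cpow _ _ _ }
  exact idealPow_apply_asIdeal f hI

/-- `ψ(𝔞)·N𝔞^s = (ψ·N^s)(𝔞)` for the twisted prime values `𝔭 ↦ ψ(𝔭) N𝔭^s`. [folklore] -/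
theorem idealPow_mul_absNorm_cpow (ψ : HeightOneSpectrum (𝓞 K) → ℂ) (s : ℂ) {I : Ideal (𝓞 K)} (hI : I ≠ ⊥) :
    idealPow K (fun v => ψ v * ((Ideal.absNorm v.asIdeal : ℕ) : ℂ) ^ s) I =
      idealPow K ψ I * ((Ideal.absNorm I : ℕ) : ℂ) ^ s := by
  rw [idealPow_mul_fun, idealPow_absNorm_cpow s hI]
  exact hI

/-- **`|ψ(𝔞)| ≤ N𝔞^{1/2}`** when `|ψ(𝔭)| ≤ N𝔭^{1/2}` at every prime (`ψ(𝔞) = heckeCharIdealValue`). [cite: Kato2004Asterisque, §15.7 (p. 256, type (−1,0))] -/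
theorem norm_heckeCharIdealValue_le (ψ : HeckeCharacter K)
    (hψ : ∀ v : HeightOneSpectrum (𝓞 K), ‖ψ.valueAtUniformizer v‖ ≤ ((Ideal.absNorm v.asIdeal : ℕ) : ℝ) ^ (1 / 2 : ℝ))
    (I : Ideal (𝓞 K)) : ‖CM.heckeCharIdealValue ψ I‖ ≤ ((Ideal.absNorm I : ℕ) : ℝ) ^ (1 / 2 : ℝ) := by
  by_cases hI : I = ⊥
  · subst hI
    rw [CM.heckeCharIdealValue_bot, norm_zero]
    positivity
  rw [heckeCharIdealValue_eq_idealPow ψ hI]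
  -- the twisted function `g = ψ · N^{-1/2}` has `|g| ≤ 1`
  set g : HeightOneSpectrum (𝓞 K) → ℂ := fun v => ψ.valueAtUniformizer v * ((Ideal.absNorm v.asIdeal : ℕ) : ℂ) ^ (-(1 / 2 : ℂ))
    with hg
  have hNpos : ∀ J : Ideal (𝓞 K), J ≠ ⊥ → 0 < Ideal.absNorm J := fun J hJ =>
    Nat.pos_of_ne_zero (Ideal.absNorm_eq_zero_iff.not.mpr (by rwa [← Submodule.zero_eq_bot] at hJ))
  have hnorm : ∀ (J : Ideal (𝓞 K)), J ≠ ⊥ → ∀ t : ℝ, ‖((Ideal.absNorm J : ℕ) : ℂ) ^ ((t : ℂ))‖ = ((Ideal.absNorm J : ℕ) : ℝ) ^ t :=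
    fun J hJ t => by rw [Complex.norm_natCast_cpow_of_pos (hNpos J hJ), Complex.ofReal_re]
  have hg1 : ∀ v : HeightOneSpectrum (𝓞 K), ‖g v‖ ≤ 1 := fun v => by
    have hv := hNpos v.asIdeal v.ne_bot
    have hpos : (0 : ℝ) < ((Ideal.absNorm v.asIdeal : ℕ) : ℝ) := by exact_mod_cast hv
    rw [hg, norm_mul, show (-(1 / 2 : ℂ)) = ((-(1 / 2) : ℝ) : ℂ) by push_cast; ring, hnorm _ v.ne_bot,
      Real.rpow_neg hpos.le, ← div_eq_mul_inv, div_le_one (Real.rpow_pos_of_pos hpos _)]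
    exact hψ v
  have h1 := norm_idealPow_le_one g hI fun v _ => hg1 v
  have hprod : idealPow K g I = idealPow K (fun v => ψ.valueAtUniformizer v) I *
      ((Ideal.absNorm I : ℕ) : ℂ) ^ (-(1 / 2 : ℂ)) := idealPow_mul_absNorm_cpow _ _ hI
  have hpos : (0 : ℝ) < ((Ideal.absNorm I : ℕ) : ℝ) := by exact_mod_cast hNpos I hI
  rw [hprod, norm_mul, show (-(1 / 2 : ℂ)) = ((-(1 / 2) : ℝ) : ℂ) by push_cast; ring, hnorm I hI,
    Real.rpow_neg hpos.le, ← div_eq_mul_inv, div_le_one (Real.rpow_pos_of_pos hpos _)] at h1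
  exact h1

end NormPow

/-! ## §C The depleted series regrouped by the norm -/

section Regroup

variable {K : Type} [Field K] [NumberField K]

/-- **`∑_𝔞 g(𝔞) N𝔞^{−s} = Σ_n (Σ_{N𝔞 = n} g(𝔞)) n^{−s}`** for any `g` with `g(0) = 0` whose ideal series converges absolutely
(the unconditional sum regrouped by the norm; the tree's `hasSum_ideal_twistCount` is the case `|g| ≤ 1`).
[cite: NeukirchANT1999, Ch. VII §8 (8.1) Proposition] -/
theorem hasSum_ideal (g : Ideal (𝓞 K) → ℂ) (hg : g ⊥ = 0) {s : ℂ}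
    (hsum : Summable fun I : Ideal (𝓞 K) => g I * ((Ideal.absNorm I : ℕ) : ℂ) ^ (-s)) :
    HasSum (fun I : Ideal (𝓞 K) => g I * ((Ideal.absNorm I : ℕ) : ℂ) ^ (-s))
      (LSeries (fun n => ∑ I ∈ NumberField.idealsOfNorm K n, g I) s) := by
  set f : Ideal (𝓞 K) → ℂ := fun I => g I * ((Ideal.absNorm I : ℕ) : ℂ) ^ (-s) with hf
  have h1 := hsum.hasSum.tsum_fiberwise (Ideal.absNorm : Ideal (𝓞 K) → ℕ)
  have h2 : ∀ n : ℕ, ∑' I : ↥((Ideal.absNorm : Ideal (𝓞 K) → ℕ) ⁻¹' {n}), f I =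
      LSeries.term (fun n => ∑ I ∈ NumberField.idealsOfNorm K n, g I) s n := by
    intro n
    have hset : ((Ideal.absNorm : Ideal (𝓞 K) → ℕ) ⁻¹' {n}) = ↑(NumberField.idealsOfNorm K n) := by
      ext I; simp
    rw [tsum_congr_set_coe f hset, Finset.tsum_subtype' (NumberField.idealsOfNorm K n) f, LSeries.term_def]
    split_ifs with hn
    · subst hn
      have : NumberField.idealsOfNorm K 0 = {⊥} := by
        ext I; simp [Ideal.absNorm_eq_zero_iff]
      rw [this, Finset.sum_singleton, hf]
      dsimp only
      rw [hg, zero_mul]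
    · rw [Finset.sum_div]
      refine Finset.sum_congr rfl fun I hI => ?_
      rw [NumberField.mem_idealsOfNorm] at hI
      rw [hf]
      dsimp only
      rw [hI, Complex.cpow_neg, div_eq_mul_inv]
  have h3 : HasSum (fun n : ℕ => LSeries.term (fun n => ∑ I ∈ NumberField.idealsOfNorm K n, g I) s n) (∑' I, f I) := by
    simpa only [h2] using h1
  rw [LSeries, h3.tsum_eq]
  exact hsum.hasSum

open scoped Classical in
/-- **The depleted twisted series as an `ℕ`-indexed Dirichlet series**: for `re s > 3/2`, `|ψ(𝔭)| ≤ N𝔭^{1/2}` and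
`|χ(𝔞)| ≤ 1` on the ideals prime to `(m)`,
`L_{(m)}(ψ̄, χ, s) = Σ_n c(n) n^{−s}` with `c(n) = Σ_{N𝔞 = n, (𝔞,(m)) = 1} \overline{ψ(𝔞)} χ(𝔞)`.
[cite: Kato2004Asterisque, Prop. 15.9 (p. 258) and §15.7 (p. 256)] -/
theorem depletedHeckeLSeries_eq_LSeries (ψ : HeckeCharacter K) (χ : absoluteGaloisGroup K →ₜ* ℂˣ) (m : ℕ)
    (hψ : ∀ v : HeightOneSpectrum (𝓞 K), ‖ψ.valueAtUniformizer v‖ ≤ ((Ideal.absNorm v.asIdeal : ℕ) : ℝ) ^ (1 / 2 : ℝ))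
    (hχ : ∀ I : Ideal (𝓞 K), IsCoprime I (Ideal.span {(m : 𝓞 K)}) → ‖heckeIdealValue χ I‖ ≤ 1)
    {s : ℂ} (hs : 3 / 2 < s.re) :
    CM.depletedHeckeLSeries ψ χ m s =
      LSeries (fun n => ∑ I ∈ NumberField.idealsOfNorm K n,
        if IsCoprime I (Ideal.span {(m : 𝓞 K)}) then conj (CM.heckeCharIdealValue ψ I) * heckeIdealValue χ I else 0) s := by
  classical
  set g : Ideal (𝓞 K) → ℂ := fun I =>
    if IsCoprime I (Ideal.span {(m : 𝓞 K)}) then conj (CM.heckeCharIdealValue ψ I) * heckeIdealValue χ I else 0 with hg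
  have hg0 : g ⊥ = 0 := by
    rw [hg]
    dsimp only
    split_ifs
    · rw [CM.heckeCharIdealValue_bot, map_zero, zero_mul]
    · rfl
  -- absolute convergence: `|g(𝔞)| ≤ N𝔞^{1/2}`, so `|g(𝔞) N𝔞^{-s}| ≤ |N𝔞^{-(s - 1/2)}|`
  have hs' : 1 < (s - 1 / 2).re := by
    simp only [Complex.sub_re, Complex.div_ofNat_re, Complex.one_re]
    linarith
  have hsum : Summable fun I : Ideal (𝓞 K) => g I * ((Ideal.absNorm I : ℕ) : ℂ) ^ (-s) := by
    refine Summable.of_norm_bounded (summable_norm_absNorm_cpow K hs') fun I => ?_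
    by_cases hI : I = ⊥
    · subst hI
      rw [hg0, zero_mul, norm_zero]
      exact norm_nonneg _
    have hpos : 0 < Ideal.absNorm I :=
      Nat.pos_of_ne_zero (Ideal.absNorm_eq_zero_iff.not.mpr (by rwa [← Submodule.zero_eq_bot] at hI))
    have hposR : (0 : ℝ) < ((Ideal.absNorm I : ℕ) : ℝ) := by exact_mod_cast hpos
    have hgle : ‖g I‖ ≤ ((Ideal.absNorm I : ℕ) : ℝ) ^ (1 / 2 : ℝ) := by
      rw [hg]
      dsimp only
      split_ifs with hc
      · rw [norm_mul, Complex.norm_conj]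
        exact (mul_le_mul (norm_heckeCharIdealValue_le ψ hψ I) (hχ I hc) (norm_nonneg _)
          (Real.rpow_nonneg hposR.le _)).trans (by rw [mul_one])
      · rw [norm_zero]; positivity
    rw [norm_mul, Complex.norm_natCast_cpow_of_pos hpos, Complex.norm_natCast_cpow_of_pos hpos, Complex.neg_re,
      Complex.neg_re, Complex.sub_re, Complex.div_ofNat_re, Complex.one_re, neg_sub, Real.rpow_sub hposR,
      div_eq_mul_inv, ← Real.rpow_neg hposR.le]
    exact mul_le_mul_of_nonneg_right hgle (Real.rpow_nonneg hposR.le _)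
  rw [← (hasSum_ideal g hg0 hsum).tsum_eq, CM.depletedHeckeLSeries]
  refine tsum_congr fun I => ?_
  rw [hg]
  dsimp only
  split_ifs <;> simp

end Regroup

/-! ## §D Weil's exponent of a type-`(1,0)` character of a totally complex field: `|ψ(ϖ_v)| = N v^{1/2}` at EVERY place -/

section Exponent

variable {K : Type} [Field K] [NumberField K]

/-- Outside any finite set of places there is another one: a number field has infinitely many finite places (above each
rational prime there is one; the tree's `infinite_heightOneSpectrum` lives in `Automorphic/JacquetLanglandsParts`, not
imported here). [cite: NeukirchANT1999, Ch. I §8] -/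
theorem exists_not_mem_finset (T : Finset (HeightOneSpectrum (𝓞 K))) : ∃ v : HeightOneSpectrum (𝓞 K), v ∉ T := by
  classical
  suffices hinf : Infinite (HeightOneSpectrum (𝓞 K)) from Infinite.exists_notMem_finset T
  have key : ∀ p : Nat.Primes, ∃ w : HeightOneSpectrum (𝓞 K), (p : 𝓞 K) ∈ w.asIdeal := by
    intro p
    haveI : (Ideal.span {(p : ℤ)}).IsMaximal :=
      Ideal.IsPrime.isMaximal ((Ideal.span_singleton_prime (by exact_mod_cast p.2.ne_zero)).mpr
        (Nat.prime_iff_prime_int.mp p.2)) (by simpa using p.2.ne_zero)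
    obtain ⟨Q, hQ, hQp⟩ := Ideal.exists_maximal_ideal_liesOver_of_isIntegral (S := 𝓞 K) (Ideal.span {(p : ℤ)})
    have hQ0 : Q ≠ ⊥ := Ring.ne_bot_of_isMaximal_of_not_isField hQ (RingOfIntegers.not_isField K)
    refine ⟨⟨Q, hQ.isPrime, hQ0⟩, ?_⟩
    have : (algebraMap ℤ (𝓞 K)) (p : ℤ) ∈ Q := by
      rw [← Ideal.mem_comap, ← Ideal.under_def, ← hQp.over]
      exact Ideal.mem_span_singleton_self _
    simpa using this
  choose w hw using key
  refine Infinite.of_injective w fun p q hpq => ?_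
  by_contra hne
  have hcop : Nat.Coprime (p : ℕ) (q : ℕ) := (Nat.coprime_primes p.2 q.2).mpr (fun h => hne (Subtype.ext h))
  have h1 := not_coprime_absNorm_of_natCast_mem (w p) (hw p)
  have h2 := coprime_absNorm_of_natCast_not_mem (w q) (m := p) ?_
  · rw [hpq] at h1; exact h1 h2
  · intro hp
    have hq := hw q
    -- `p, q ∈ w q` coprime ⇒ `1 ∈ w q`
    obtain ⟨a, b, hab⟩ := Nat.Coprime.isCoprime hcop
    apply (w q).isPrime.ne_top
    rw [Ideal.eq_top_iff_one]
    have : (1 : 𝓞 K) = (a : 𝓞 K) * (p : ℕ) + (b : 𝓞 K) * (q : ℕ) := by exact_mod_cast hab.symm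
    rw [this]
    exact Ideal.add_mem _ (Ideal.mul_mem_left _ _ hp) (Ideal.mul_mem_left _ _ hq)

/-- **Weil's exponent of a type-`(1,0)` Grössencharacter is `−1/2`: `|ψ(ϖ_v)| = N v^{1/2}` at EVERY finite place** of a
totally complex `K` (the tree's `HasInfinityType.norm_valueAtUniformizer_sq` gives `|ψ(ϖ_v)|² = N v` off a module of
definition, weight `w = 1` since every infinite place has `mult = 2`; Weil's `|ψ(ϖ_v)| = N v^{−σ}` holds at ALL places
with one `σ`, `norm_valueAtUniformizer_of_norm_eq_rpow`). [cite: Weil1956] [cite: WeilBNT1967, Ch. VII §7 (first paragraph)] -/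
theorem norm_valueAtUniformizer_of_hasInfinityType_one_zero [IsTotallyComplex K] (ψ : HeckeCharacter K)
    (hinf : ψ.HasInfinityType (fun _ => 1) (fun _ => 0)) (v : HeightOneSpectrum (𝓞 K)) :
    ‖ψ.valueAtUniformizer v‖ = ((Ideal.absNorm v.asIdeal : ℕ) : ℝ) ^ (1 / 2 : ℝ) := by
  obtain ⟨σ, -, hσ⟩ := ψ.exists_norm_valueAtUniformizer_eq_rpow_neg
  obtain ⟨T, e, hmod⟩ := ψ.exists_isModulus
  obtain ⟨v₀, hv₀⟩ := exists_not_mem_finset T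
  have hw : ∀ w : InfinitePlace K, 2 * ((fun _ => (1 : ℤ)) w + (fun _ => (0 : ℤ)) w) = (1 : ℤ) * w.mult := by
    intro w
    rw [NumberField.InfinitePlace.mult, if_neg (InfinitePlace.not_isReal_iff_isComplex.mpr (IsTotallyComplex.isComplex w))]
    norm_num
  have hsq := hinf.norm_valueAtUniformizer_sq hmod hw hv₀
  rw [zpow_one, hσ v₀] at hsq
  -- `(N v₀^{-σ})² = N v₀` forces `-σ = 1/2`
  have hN1 : (1 : ℝ) < (v₀.residueCard : ℝ) := by exact_mod_cast v₀.one_lt_residueCard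
  have hN0 : (0 : ℝ) < (v₀.residueCard : ℝ) := lt_trans zero_lt_one hN1
  have hres : (v₀.residueCard : ℝ) = (Ideal.absNorm v₀.asIdeal : ℝ) := rfl
  rw [← hres, ← Real.rpow_natCast, ← Real.rpow_mul hN0.le] at hsq
  conv_rhs at hsq => rw [← Real.rpow_one (v₀.residueCard : ℝ)]
  have hexp : -σ * (2 : ℕ) = 1 := (Real.rpow_right_inj hN0 hN1.ne').mp hsq
  have hσ' : -σ = 1 / 2 := by push_cast at hexp; linarith
  rw [hσ v, hσ']
  rfl

end Exponent

end DepletedSeries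

end Summit.BirchSwinnertonDyer.Rank1Residual.Additive.GenusSeven

end
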